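import Literature.AlgebraicGeometry.Resolution.QuadraticTransforms
import Summits.ResolutionOfSingularities.ResolutionOfSingularities.Theorems.ValuativeLuAlphaPTorsorQuadraticDerivation

/-!
# Steer core (`n = 4`), part 3/3: the Jacobian thinness budget

OURS (campaign res-hironaka, rung L, slot W4.1, author seat res-L0-w41-idea-1 gen 3; replaces the role of no printed item;
NOT a statement of the manuscript under review; AI-produced, weaker than expert review). Landed for the author by the
prover seat res-type-028 (the ideator seat cannot propose under `Theorems/`), `--supports stmt-ResolutionOfSingularities-16345`
(crux `Steer`, routes FrobeniusClosing / WildCones, line `switching_dichotomy` r12). Source of record: the author's candidate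
file `SteerRankThinness.lean` (evidence #53 on stmt-ResolutionOfSingularities-16345, sha16 40e1bd0579b924b9, 711 lines,
farm-clean, 0 sorries, standard axioms), split into three files ≤ 400 lines with every declaration byte-identical (only the
ORDER of `HasProperCoarsening` / `rankOne_of_not_hasProperCoarsening` moved from the head of §5 into part 2, so that part 1
is definition-free): `FrobeniusClosingSteerCore4CompositeRank.lean` (§5a: the CP2019 model lemmas),
`FrobeniusClosingSteerCore4CompositeRankConcl.lean` (§5b: `HasProperCoarsening`, rank dichotomy, dimension split, affine
model, `Concl`, crux-facing form), `FrobeniusClosingSteerJacobianThinness.lean` (§6: Jacobian value budget, no eternal run at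
infinite thinness). Vocabulary of the registered skeleton (`Concl`, `IsExcParam`, `IsStrictStep`, `IsTorsorRunUpTo`,
`IsTorsorRun`) is INLINED verbatim as local `def`s, as the author wrote them; consumption in the skeleton is by definitional
unfolding.

This part (§6): the inlined r12 vocabulary `IsExcParam` / `IsStrictStep` / `IsTorsorRunUpTo` / `IsTorsorRun`,
`exists_derivation_smul_quadraticTransformAlong` (6a), `jacobianStepLaw` (6b), `jacobianValueBudget` (6c):
`v(δ(t^p)) ≤ ∏_{i<N} v(x_i)^(p-1)` for every `δ ∈ Der_ℤ(R 0)` along a torsor run, `InfiniteThinness`, and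
`not_isTorsorRun_of_infiniteThinness` (6d): no ETERNAL torsor run along a quadratic sequence of infinite thinness.
-/

noncomputable section

-- single-problem summit: the doubled namespace component `ResolutionOfSingularities` is forced
set_option linter.dupNamespace false

open scoped BigOperators Classical

namespace Summit.ResolutionOfSingularities.ResolutionOfSingularities.Theorems.SteerRankThinness

/-! ## §6 (gen 3, card `jacobian-thinness`) — the Jacobian value budget restricts the VALUATION, not the run

OURS (rung L, slot W4.1; NOT a statement of the manuscript under review). The intrinsic law behind idea-2's (B5) and
tri-1's K3core "summable budget": a derivation `δ ∈ Der_ℤ(R_i)` pushes to the quadratic transform as `x • δ ∈ Der_ℤ(R_{i+1})`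
(`x` an exceptional parameter; the tree-PROVED H4 `PfaffLine.exists_derivation_quadraticTransformAlong` applied to the
LOGARITHMIC derivation `x • δ` — (6a), PROVED), and along a strict step `s = x s' + g` of the torsor generator, in
characteristic `p`, `δ (s ^ p) = x ^ (p-1) · (x • δ)(s' ^ p)` ((6b), PROVED: `s ^ p = x ^ p s' ^ p + g ^ p` and `δ₁` kills
`p`-th powers up to the factor `p = 0`). Telescoped along a torsor run up to `N` ((6c), PROVED, induction):
`v (δ (t ^ p)) ≤ ∏_{i<N} v(x_i)^{p-1}` for EVERY `δ ∈ Der_ℤ(R 0)` — rank-free and multiplicative. Reading it as a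
constraint on the pair (valuation, centre) rather than as a termination argument: an ETERNAL run forces FINITE THINNESS of
the quadratic sequence (`∏_i v(𝔪_{R_i}) ↛ 0`), so ((6d), PROVED from (6c)) there is NO eternal torsor run along a quadratic
sequence of INFINITE THINNESS (`InfiniteThinness`) once some `δ (t ^ p) ≠ 0` (automatic for `t ^ p ∉ K ^ p`, `k`
perfect). The eternal regime R2 of `stub_core4EternalNonIsolated` is therefore EMPTY along: every discrete rank-one
valuation, every `W`-type valuation of stub-4 (`CORE4-INHABITANT.md`: exponents `(j+2)!`-lacunary), every valuation
whose Puiseux exponents grow super-geometrically; and between two stalls at most `v(J f_i) / ((p-1)·v(𝔪_i))` consecutive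
free steps occur. NOT claimed (dead end (★) of NOTES): that strongly switching or rank one forces infinite thinness — the
golden monomial valuation and the exponents `1 + Σ_{i≤j} p^{-i²}` have finite thinness.
-/

section Thinness

open IsLocalRing
open Literature.AlgebraicGeometry.Resolution (IsQuadraticTransformAlong)
open Summit.ResolutionOfSingularities.ResolutionOfSingularities.Theorems.PfaffLine
  (exists_derivation_quadraticTransformAlong)

variable {K : Type} [Field K]

/-- Verbatim r8 vocabulary (lead-1 `Steer_r12.lean`): an EXCEPTIONAL PARAMETER of `S` along `O` — a non-zero
element of `S` of value `< 1` and of maximal value among those. [folklore] -/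
def IsExcParam (O : ValuationSubring K) (S : Subring K) (x : K) : Prop :=
  x ∈ S ∧ x ≠ 0 ∧ O.valuation x < 1 ∧ ∀ y ∈ S, O.valuation y < 1 → O.valuation y ≤ O.valuation x

/-- Verbatim r8 vocabulary: one strict-transform step `s = x * s' + g`. [folklore] -/
def IsStrictStep (O : ValuationSubring K) (S : Subring K) (s s' : K) : Prop :=
  ∃ x g : K, IsExcParam O S x ∧ g ∈ S ∧ s = x * s' + g

/-- Verbatim r8 vocabulary: a torsor run up to stage `N`. [folklore] -/
def IsTorsorRunUpTo (O : ValuationSubring K) (R : ℕ → Subring K) (t : K) (p : ℕ) (s : ℕ → K)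
    (N : ℕ) : Prop :=
  s 0 = t ∧ (∀ i ≤ N, s i ^ p ∈ R i) ∧ ∀ i < N, IsStrictStep O (R i) (s i) (s (i + 1))

/-- Verbatim r8 vocabulary: an eternal torsor run. [folklore] -/
def IsTorsorRun (O : ValuationSubring K) (R : ℕ → Subring K) (t : K) (p : ℕ) (s : ℕ → K) : Prop :=
  s 0 = t ∧ (∀ i, s i ^ p ∈ R i) ∧ ∀ i, IsStrictStep O (R i) (s i) (s (i + 1))

/-- **(6a) Derivations push to the quadratic transform after scaling by an element of the centre** (PROVED from the
tree's H4 `exists_derivation_quadraticTransformAlong`: `x • δ` is logarithmic): for `x ∈ 𝔪_S` and `δ ∈ Der_ℤ(S)` there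
is `δ₁ ∈ Der_ℤ(S₁)` with `δ₁|_S = x · δ`. [folklore] -/
theorem exists_derivation_smul_quadraticTransformAlong (O : ValuationSubring K) (S S₁ : Subring K)
    [IsLocalRing S] (h : IsQuadraticTransformAlong O S S₁) (x : S) (hx : x ∈ maximalIdeal S)
    (δ : Derivation ℤ S S) :
    ∃ δ₁ : Derivation ℤ S₁ S₁, ∀ a : S,
      δ₁ (Subring.inclusion h.le a) = Subring.inclusion h.le (x * δ a) := by
  obtain ⟨δ₁, hδ₁⟩ := exists_derivation_quadraticTransformAlong O S S₁ h (x • δ) fun y _ => by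
    rw [Derivation.smul_apply, smul_eq_mul]
    exact Ideal.mul_mem_right _ _ hx
  exact ⟨δ₁, fun a => by rw [hδ₁, Derivation.smul_apply, smul_eq_mul]⟩

/-- **(6b) The one-step Jacobian law** (PROVED; elementary): if `δ₁|_S = x · δ`, `s = x * s' + g` with
`g, x ∈ S`, `x ≠ 0`, `s ^ p ∈ S`, `s' ^ p ∈ S₁`, then in characteristic `p`
`δ (s ^ p) = x ^ (p - 1) * δ₁ (s' ^ p)`: indeed `x · δ (s ^ p) = δ₁ (x ^ p s' ^ p + g ^ p) = x ^ p δ₁ (s' ^ p)` because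
`δ₁ (x ^ p) = p x^{p-1} δ₁ x = 0` and `δ₁ (g ^ p) = 0`. Consequence: `J(f_i) S_{i+1} ⊆ x_i^{p-1} J(f_{i+1})` for the
derivative ideals of the successive radicands. [folklore] -/
theorem jacobianStepLaw (p : ℕ) [Fact p.Prime] [CharP K p] {S S₁ : Subring K} (hle : S ≤ S₁)
    (x : K) (hxS : x ∈ S) (hx0 : x ≠ 0) (δ : Derivation ℤ S S) (δ₁ : Derivation ℤ S₁ S₁)
    (hδ₁ : ∀ a : S, ((δ₁ (Subring.inclusion hle a) : S₁) : K) = x * ((δ a : S) : K))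
    (s s' g : K) (hg : g ∈ S) (hs : s = x * s' + g) (hsp : s ^ p ∈ S) (hs'p : s' ^ p ∈ S₁) :
    ((δ ⟨s ^ p, hsp⟩ : S) : K) = x ^ (p - 1) * ((δ₁ ⟨s' ^ p, hs'p⟩ : S₁) : K) := by
  have hp : p.Prime := Fact.out
  have hpK : (p : K) = 0 := CharP.cast_eq_zero K p
  -- the identity `s ^ p = x ^ p * s' ^ p + g ^ p` inside `S₁`
  have hSP : Subring.inclusion hle ⟨s ^ p, hsp⟩ =
      (⟨x, hle hxS⟩ : S₁) ^ p * ⟨s' ^ p, hs'p⟩ + (⟨g, hle hg⟩ : S₁) ^ p := by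
    apply Subtype.ext
    simp only [Subring.coe_inclusion, Subring.coe_add, Subring.coe_mul, Subring.coe_pow]
    rw [hs, add_pow_char, mul_pow]
  -- apply `δ₁` and push to `K`
  have h1 := hδ₁ ⟨s ^ p, hsp⟩
  rw [hSP, map_add, Derivation.leibniz, Derivation.leibniz_pow, Derivation.leibniz_pow] at h1
  simp only [smul_eq_mul, nsmul_eq_mul, Subring.coe_add, Subring.coe_mul, Subring.coe_pow,
    Subring.coe_natCast, hpK, zero_mul, mul_zero, add_zero] at h1
  have hxp : x ^ p = x * x ^ (p - 1) := by
    rw [← pow_succ', Nat.sub_add_cancel hp.one_lt.le]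
  rw [hxp, mul_assoc] at h1
  exact (mul_left_cancel₀ hx0 h1).symm

/-- **(6c) The Jacobian VALUE BUDGET along a torsor run** (PROVED; induction on `N` with (6a), (6b), and
`v (δ_N (s_N ^ p)) ≤ 1`): along a quadratic sequence `R` inside `O` and a torsor run of `t` up to stage `N`,
for EVERY `δ ∈ Der_ℤ(R 0)` and every choice of exceptional parameters `x i` of the `R i`,
`v (δ (t ^ p)) ≤ ∏_{i<N} v (x i) ^ (p-1)`. Rank-free, multiplicative; the value of an exceptional parameter is
independent of its choice. [folklore] -/
theorem jacobianValueBudget (p : ℕ) [Fact p.Prime] [CharP K p] (O : ValuationSubring K)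
    (R : ℕ → Subring K) (hRO : ∀ i, R i ≤ O.toSubring)
    (hR : ∀ i, IsQuadraticTransformAlong O (R i) (R (i + 1)))
    (t : K) (ht : t ^ p ∈ R 0) (s : ℕ → K) (N : ℕ) (hrun : IsTorsorRunUpTo O R t p s N)
    (δ : Derivation ℤ (R 0) (R 0)) (x : ℕ → K) (hx : ∀ i < N, IsExcParam O (R i) (x i)) :
    O.valuation ((δ ⟨t ^ p, ht⟩ : R 0) : K) ≤ ∏ i ∈ Finset.range N, O.valuation (x i) ^ (p - 1) := by
  induction N generalizing R t s δ x with
  | zero =>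
    rw [Finset.prod_range_zero]
    exact (O.valuation_le_one_iff _).mpr (hRO 0 (δ ⟨t ^ p, ht⟩).2)
  | succ N ih =>
    -- the first step of the run: `s 0 = x₀ * s 1 + g`
    obtain ⟨x₀, g, hx₀, hg, hstep⟩ := hrun.2.2 0 (Nat.succ_pos N)
    -- `R 0` is local and `x₀ ∈ 𝔪_{R 0}` (a unit of `R 0 ⊆ O` has value `1`)
    obtain ⟨hloc, -⟩ := hR 0
    have hx₀m : (⟨x₀, hx₀.1⟩ : R 0) ∈ maximalIdeal (R 0) := by
      rw [IsLocalRing.mem_maximalIdeal, mem_nonunits_iff, isUnit_iff_exists_inv]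
      rintro ⟨b, hb⟩
      have hbK : x₀ * (b : K) = 1 := by
        have := congrArg (fun z : R 0 => (z : K)) hb
        simpa using this
      have hb1 : O.valuation (b : K) ≤ 1 := (O.valuation_le_one_iff _).mpr (hRO 0 b.2)
      have hlt : O.valuation (x₀ * (b : K)) < 1 := by
        rw [map_mul]
        calc O.valuation x₀ * O.valuation (b : K) ≤ O.valuation x₀ * 1 := by gcongr
          _ < 1 := by rw [mul_one]; exact hx₀.2.2.1
      rw [hbK, map_one] at hlt
      exact lt_irrefl _ hlt
    -- push `δ` to `R 1` as `x₀ • δ`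
    obtain ⟨δ₁, hδ₁⟩ :=
      exists_derivation_smul_quadraticTransformAlong O (R 0) (R 1) (hR 0) ⟨x₀, hx₀.1⟩ hx₀m δ
    have hδ₁K : ∀ a : R 0,
        ((δ₁ (Subring.inclusion (hR 0).le a) : R 1) : K) = x₀ * ((δ a : R 0) : K) := by
      intro a
      rw [hδ₁, Subring.coe_inclusion, Subring.coe_mul]
    -- the one-step law at stage `0`
    have hs0p : s 0 ^ p ∈ R 0 := hrun.2.1 0 (Nat.zero_le _)
    have hs1p : s 1 ^ p ∈ R 1 := hrun.2.1 1 (by omega)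
    have hlaw := jacobianStepLaw p (hR 0).le x₀ hx₀.1 hx₀.2.1 δ δ₁ hδ₁K (s 0) (s 1) g hg hstep
      hs0p hs1p
    have heq : (⟨t ^ p, ht⟩ : R 0) = ⟨s 0 ^ p, hs0p⟩ :=
      Subtype.ext (show t ^ p = s 0 ^ p by rw [hrun.1])
    -- the shifted run from stage `1`, and the induction hypothesis for `δ₁`
    have hrun' : IsTorsorRunUpTo O (fun i => R (i + 1)) (s 1) p (fun i => s (i + 1)) N :=
      ⟨rfl, fun i hi => hrun.2.1 (i + 1) (by omega), fun i hi => hrun.2.2 (i + 1) (by omega)⟩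
    have ih' := ih (fun i => R (i + 1)) (fun i => hRO (i + 1)) (fun i => hR (i + 1)) (s 1) hs1p
      (fun i => s (i + 1)) hrun' δ₁ (fun i => x (i + 1)) (fun i hi => hx (i + 1) (by omega))
    -- exceptional parameters of `R 0` all have the same value
    have hx0 := hx 0 (Nat.succ_pos N)
    have hv0 : O.valuation x₀ = O.valuation (x 0) :=
      le_antisymm (hx0.2.2.2 x₀ hx₀.1 hx₀.2.2.1) (hx₀.2.2.2 (x 0) hx0.1 hx0.2.2.1)
    rw [heq, hlaw, map_mul, map_pow, hv0, Finset.prod_range_succ', mul_comm]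
    gcongr

/-- The quadratic sequence `R` along `O` has INFINITE THINNESS: the products of the values of the successive
exceptional parameters eventually drop below the value of any fixed non-zero element (for `O` of rank one:
`Σ_i -log v(x_i) = ∞`; cf. Favre–Jonsson's thinness `A(ν) = Σ m_i` on the valuative tree). Discrete rank-one valuations,
the `W`-type valuations of stub-4 (exponents `(j+2)! + …`) and all valuations with super-geometric Puiseux exponents have it;
the golden monomial valuation and divisorial-limit valuations with exponents `1 + Σ p^{-i²}` do not. [folklore] -/
def InfiniteThinness (O : ValuationSubring K) (R : ℕ → Subring K) : Prop :=
  ∀ y : K, y ≠ 0 → ∃ N : ℕ, ∀ x : ℕ → K, (∀ i < N, IsExcParam O (R i) (x i)) →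
    ∏ i ∈ Finset.range N, O.valuation (x i) < O.valuation y

/-- **(6d) No eternal torsor run along a quadratic sequence of infinite thinness** (PROVED):
if some `δ ∈ Der_ℤ(R 0)` does not kill `t ^ p` (automatic when `t ^ p ∉ K ^ p` and `k` is perfect), the budget
`v (δ (t ^ p)) ≤ ∏_{i<N} v(x_i)^{p-1} ≤ ∏_{i<N} v(x_i)` contradicts infinite thinness at a large stage `N`. So the
eternal regime R2 of `stub_core4EternalNonIsolated` only lives on quadratic sequences of FINITE thinness. [folklore] -/
theorem not_isTorsorRun_of_infiniteThinness (p : ℕ) [Fact p.Prime] [CharP K p] (O : ValuationSubring K)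
    (R : ℕ → Subring K) (hRO : ∀ i, R i ≤ O.toSubring)
    (hR : ∀ i, IsQuadraticTransformAlong O (R i) (R (i + 1)))
    (hthin : InfiniteThinness O R) (t : K) (ht : t ^ p ∈ R 0)
    (hδ : ∃ δ : Derivation ℤ (R 0) (R 0), ((δ ⟨t ^ p, ht⟩ : R 0) : K) ≠ 0) (s : ℕ → K) :
    ¬ IsTorsorRun O R t p s := by
  classical
  intro hrun
  obtain ⟨δ, hδ0⟩ := hδ
  obtain ⟨N, hN⟩ := hthin _ hδ0
  have hex : ∀ i, ∃ x : K, IsExcParam O (R i) x := fun i => by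
    obtain ⟨x, g, hxe, -, -⟩ := hrun.2.2 i
    exact ⟨x, hxe⟩
  choose x hx using hex
  have hupto : IsTorsorRunUpTo O R t p s N :=
    ⟨hrun.1, fun i _ => hrun.2.1 i, fun i _ => hrun.2.2 i⟩
  have hbud := jacobianValueBudget p O R hRO hR t ht s N hupto δ x fun i _ => hx i
  have hlt := hN x fun i _ => hx i
  have hp1 : 1 ≤ p - 1 := by
    have := (Fact.out : p.Prime).two_le
    omega
  have hle : ∏ i ∈ Finset.range N, O.valuation (x i) ^ (p - 1) ≤
      ∏ i ∈ Finset.range N, O.valuation (x i) := by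
    refine Finset.prod_le_prod' fun i _ => ?_
    have h1 : O.valuation (x i) ≤ 1 := (O.valuation_le_one_iff _).mpr (hRO i (hx i).1)
    calc O.valuation (x i) ^ (p - 1) ≤ O.valuation (x i) ^ 1 := pow_le_pow_right_of_le_one' h1 hp1
      _ = O.valuation (x i) := pow_one _
  exact absurd (hbud.trans hle) (not_le.mpr hlt)

end Thinness

end Summit.ResolutionOfSingularities.ResolutionOfSingularities.Theorems.SteerRankThinness
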